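import Literature.NumberTheory.LFunctions.BondarenkoHeap2026Section2Proofs
import Literature.NumberTheory.LFunctions.SelbergArchimedeanIntegral
import HarnessLib

/-!
# Bondarenko–Heap 2026, Proposition 1 — module M3: the archimedean term

Topic `Literature/NumberTheory/LFunctions` (namespace
`Literature.NumberTheory.LFunctions.BondarenkoHeap2026.Arch`). PROOF LAYER (theorems only: no
definitions, no named facts) of the `proposition1` programme of cell `rh-crit/ah` (C5), module M3
(seat t5; M1 = test function `Prop1TestFunction`, M2 = prime/zero sides, M4 = assembly). LABEL:
**NOT RH-BEARING** — unconditional real-analysis estimates for the `Γ'/Γ`-term of the explicit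
formula applied to the window functional `B_{T,h}`; RH is not mentioned; nothing here bears on the
truth of RH.

A. Bondarenko, W. Heap, *Siegel zeros and small gaps between zeros of the Riemann zeta function*
(arXiv:2608.07399v1, 2026), §2.2, proof of Proposition 1: `I₁ = Σ_γ B_{T,h}(γ)` with (4) `B_{T,h}(u) = ∫ 1_{|u−t|<h/2} |R(t)|²
W_T(t) dt`, and in the Guinand–Weil explicit formula for `B_{T,h}` the archimedean term
`(1/2π) ∫ B_{T,h}(u) Re (Γ'/Γ)(1/4 + iu/2) du` contributes the main term `c I₀` (with
`h = 2πc/log T`) up to admissible errors.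

## What is proved (interfaces for M4; all over the REAL objects of `BondarenkoHeap2026Section2`)

* (M3-a) `Arch.exists_abs_setIntegral_reDigammaQuarter_sub_le`:
  `∃ C ≥ 0, ∀ h ∈ (0,1], ∀ t, 4 ≤ |t| → |∫_{u ∈ (t−h/2, t+h/2)} Re ψ(1/4 + iu/2) du − h log(|t|/2)| ≤ C h`
  (from the tree's `exists_abs_reDigammaQuarter_sub_log_half_le`, `|Re ψ(1/4+iu/2) − log(t/2)| ≤
  C + 3√|u − t|` for `t ≥ 4`, made two-sided by `reDigammaQuarter_even`).
* (M3-b) `Arch.abs_setIntegral_reDigammaQuarter_le`: for `|t| ≤ 4`, `|∫_{(t−h/2,t+h/2)} Re ψ| ≤ C′ h`,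
  `C′ = |Re ψ(1/4)| + 27·(9/2)²` (`abs_reDigammaQuarter_le`); combined form
  `Arch.exists_abs_setIntegral_reDigammaQuarter_sub_indicator_le` with
  `ℓ(t) = 1_{|t|≥4} log(|t|/2)`.
* (M3-c) `Arch.integral_window_mul_eq` (Fubini): for `T > 0`, `0 < h ≤ 1` and any continuous `ψ`
  with `|ψ(u)| ≤ K + |u|`,
  `∫ (∫_{t∈(u−h/2,u+h/2)} |R(t)|² W_T(t) dt) ψ(u) du = ∫ |R(t)|² W_T(t) (∫_{u∈(t−h/2,t+h/2)} ψ(u) du) dt`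
  (kernel integrable on `ℝ × ℝ`: `Arch.integrable_windowKernel`, from `Extension.integrable_weight`,
  `Extension.integrable_abs_mul_weight` and `‖R(t)‖ ≤ Σ|r(n)|`); `ψ ≡ 1` gives
  `∫ B_{T,h} = h I₀` (`Arch.integral_window_eq`).
* (M3-d) `Arch.exists_abs_integral_window_mul_reDigammaQuarter_sub_le`: one absolute `C ≥ 0` with
  `|∫ B_{T,h}(u) Re ψ(1/4 + iu/2) du − h ∫ |R(t)|² W_T(t) ℓ(t) dt| ≤ C h ∫ |R(t)|² W_T(t) dt`
  for all `w, B, r, L`, `T > 0`, `h ∈ (0, 1]`; and in the frozen interface shape (ah/STATUS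
  07:51:43Z) `Arch.exists_abs_archimedean_bWindow_sub_le`:
  `|(1/2π)∫ bWindow · Re ψ − (gapWidth/2π) ∫_{|t|≥4} |R|² W_T log(|t|/2)| ≤ (C/2π) gapWidth · I0R`.
  The localisation `log(|t|/2) ≈ log T` on the mass of `W_T` (giving `c I₀`) is M4's step.

## References

* [BondarenkoHeap2026] §2.1 (1)–(4), §2.2 Proposition 1 and its proof (archimedean term).
* [Yoshida1992] §2 (2.1): the archimedean density `Re ψ(1/4 + it/2)` (tree `reDigammaQuarter`).
-/

noncomputable section

open scoped Real Topology
open Filter Set MeasureTheory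

namespace Literature.NumberTheory.LFunctions

namespace BondarenkoHeap2026

namespace Arch

open Literature.Analysis.SpecialFunctions

/-! ## M3-a/b. The window integral of the archimedean density `Re ψ(1/4 + iu/2)` -/

/-- Pointwise, two-sided version of the tree's `exists_abs_reDigammaQuarter_sub_log_half_le`:
`|Re ψ(1/4 + iu/2) − log(|t|/2)| ≤ C + 3√|u − t|` for `|t| ≥ 4` (evenness of `Re ψ(1/4 + iu/2)` in `u`
for `t ≤ −4`). [cite: BondarenkoHeap2026, §2.2 (proof of Proposition 1, archimedean term)] -/
theorem exists_abs_reDigammaQuarter_sub_log_abs_half_le :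
    ∃ C : ℝ, 0 ≤ C ∧ ∀ t : ℝ, 4 ≤ |t| → ∀ u : ℝ,
      |reDigammaQuarter u - Real.log (|t| / 2)| ≤ C + 3 * Real.sqrt |u - t| := by
  obtain ⟨C, hC0, hC⟩ := exists_abs_reDigammaQuarter_sub_log_half_le
  refine ⟨C, hC0, fun t ht u ↦ ?_⟩
  rcases le_or_gt 0 t with h | h
  · rw [abs_of_nonneg h] at ht ⊢
    exact hC t ht u
  · rw [abs_of_neg h] at ht ⊢
    have h1 := hC (-t) ht (-u)
    rw [reDigammaQuarter_even] at h1
    refine h1.trans (le_of_eq ?_)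
    rw [show -u - -t = -(u - t) by ring, abs_neg]

/-- A global majorant: `|Re ψ(1/4 + iu/2)| ≤ K + |u|` for all `u` (the linear growth used to
justify the `u`-integration of the archimedean term against `B_{T,h}`).
[cite: BondarenkoHeap2026, §2.2 (proof of Proposition 1, archimedean term)] -/
theorem exists_abs_reDigammaQuarter_le_add_abs :
    ∃ K : ℝ, 0 ≤ K ∧ ∀ u : ℝ, |reDigammaQuarter u| ≤ K + |u| := by
  obtain ⟨C, hC0, hC⟩ := exists_abs_reDigammaQuarter_sub_log_abs_half_le
  refine ⟨C + |reDigammaQuarter 0| + 27 * 4 ^ 2, by positivity, fun u ↦ ?_⟩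
  rcases le_or_gt 4 |u| with h | h
  · have h1 := hC u h u
    rw [sub_self, abs_zero, Real.sqrt_zero, mul_zero, add_zero] at h1
    have hlog : Real.log (|u| / 2) ≤ |u| := by
      have h2 : Real.log (|u| / 2) ≤ |u| / 2 - 1 := Real.log_le_sub_one_of_pos (by linarith)
      linarith [abs_nonneg u]
    have hlog0 : 0 ≤ Real.log (|u| / 2) := Real.log_nonneg (by linarith)
    have := abs_sub_abs_le_abs_sub (reDigammaQuarter u) (Real.log (|u| / 2))
    rw [abs_of_nonneg hlog0] at this
    nlinarith [abs_nonneg (reDigammaQuarter 0)]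
  · have h1 := abs_reDigammaQuarter_le u
    have h2 : u ^ 2 ≤ 4 ^ 2 := by rw [← sq_abs]; exact pow_le_pow_left₀ (abs_nonneg u) h.le 2
    nlinarith [abs_nonneg u]

/-- `Re ψ(1/4 + iu/2)` is integrable on every bounded window. [folklore] -/
private theorem integrableOn_reDigammaQuarter_Ioo (a b : ℝ) :
    IntegrableOn reDigammaQuarter (Ioo a b) :=
  (continuous_reDigammaQuarter.integrableOn_Icc (a := a) (b := b)).mono_set Ioo_subset_Icc_self

/-- **M3-a. The window integral of the archimedean density, `|t| ≥ 4`:**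
`|∫_{t−h/2}^{t+h/2} Re ψ(1/4 + iu/2) du − h log(|t|/2)| ≤ C h` for `0 < h ≤ 1`, `|t| ≥ 4`
(the archimedean term of the explicit formula applied to the window `1_{|u−t|<h/2}`; BH 2026, proof of
Proposition 1: "the integral term contributes `c I₀ + O(I₀/log T)`").
[cite: BondarenkoHeap2026, §2.2 (proof of Proposition 1, archimedean term)] -/
theorem exists_abs_setIntegral_reDigammaQuarter_sub_le :
    ∃ C : ℝ, 0 ≤ C ∧ ∀ h : ℝ, 0 < h → h ≤ 1 → ∀ t : ℝ, 4 ≤ |t| →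
      |(∫ u in Ioo (t - h / 2) (t + h / 2), reDigammaQuarter u) - h * Real.log (|t| / 2)| ≤ C * h := by
  obtain ⟨C, hC0, hC⟩ := exists_abs_reDigammaQuarter_sub_log_abs_half_le
  refine ⟨C + 3, by positivity, fun h hh hh1 t ht ↦ ?_⟩
  have hvol : volume (Ioo (t - h / 2) (t + h / 2)) = ENNReal.ofReal h := by
    rw [Real.volume_Ioo]; congr 1; ring
  have hvol' : volume.real (Ioo (t - h / 2) (t + h / 2)) = h := by
    rw [Measure.real, hvol, ENNReal.toReal_ofReal hh.le]
  have e : (∫ u in Ioo (t - h / 2) (t + h / 2), reDigammaQuarter u) - h * Real.log (|t| / 2) =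
      ∫ u in Ioo (t - h / 2) (t + h / 2), (reDigammaQuarter u - Real.log (|t| / 2)) := by
    rw [integral_sub (integrableOn_reDigammaQuarter_Ioo _ _) (integrableOn_const (by rw [hvol]; simp)),
      setIntegral_const, hvol', smul_eq_mul]
  rw [e]
  have hbound : ∀ u ∈ Ioo (t - h / 2) (t + h / 2), ‖reDigammaQuarter u - Real.log (|t| / 2)‖ ≤ C + 3 := by
    intro u hu
    rw [Real.norm_eq_abs]
    refine (hC t ht u).trans ?_
    have hut : |u - t| ≤ 1 := by
      rw [abs_le]; constructor <;> linarith [hu.1, hu.2]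
    have : Real.sqrt |u - t| ≤ 1 := by
      rw [show (1 : ℝ) = Real.sqrt 1 by simp]
      exact Real.sqrt_le_sqrt hut
    linarith
  have hI := norm_setIntegral_le_of_norm_le_const (by rw [hvol]; simp) hbound
  rw [Real.norm_eq_abs, hvol'] at hI
  exact hI

/-- **M3-b. The window integral of the archimedean density, `|t| ≤ 4`:**
`|∫_{t−h/2}^{t+h/2} Re ψ(1/4 + iu/2) du| ≤ C′ h` for `0 < h ≤ 1`, with
`C′ = |Re ψ(1/4)| + 27·(9/2)²` (`abs_reDigammaQuarter_le`).
[cite: BondarenkoHeap2026, §2.2 (proof of Proposition 1, archimedean term)] -/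
theorem abs_setIntegral_reDigammaQuarter_le {h : ℝ} (hh : 0 < h) (hh1 : h ≤ 1) {t : ℝ} (ht : |t| ≤ 4) :
    |∫ u in Ioo (t - h / 2) (t + h / 2), reDigammaQuarter u| ≤
      (|reDigammaQuarter 0| + 27 * (9 / 2) ^ 2) * h := by
  have hvol : volume (Ioo (t - h / 2) (t + h / 2)) = ENNReal.ofReal h := by
    rw [Real.volume_Ioo]; congr 1; ring
  have hvol' : volume.real (Ioo (t - h / 2) (t + h / 2)) = h := by
    rw [Measure.real, hvol, ENNReal.toReal_ofReal hh.le]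
  have hbound : ∀ u ∈ Ioo (t - h / 2) (t + h / 2), ‖reDigammaQuarter u‖ ≤
      |reDigammaQuarter 0| + 27 * (9 / 2) ^ 2 := by
    intro u hu
    rw [Real.norm_eq_abs]
    refine (abs_reDigammaQuarter_le u).trans ?_
    have hu' : |u| ≤ 9 / 2 := by
      have := abs_le.mp ht
      rw [abs_le]; constructor <;> linarith [hu.1, hu.2]
    have : u ^ 2 ≤ (9 / 2) ^ 2 := by rw [← sq_abs]; exact pow_le_pow_left₀ (abs_nonneg u) hu' 2
    nlinarith
  have hI := norm_setIntegral_le_of_norm_le_const (by rw [hvol]; simp) hbound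
  rw [Real.norm_eq_abs, hvol'] at hI
  exact hI

/-- **M3-a/b combined:** with `ℓ(t) := log(|t|/2)` for `|t| ≥ 4` and `0` otherwise,
`|∫_{t−h/2}^{t+h/2} Re ψ(1/4 + iu/2) du − h ℓ(t)| ≤ C h` for all `t` and `0 < h ≤ 1`.
[cite: BondarenkoHeap2026, §2.2 (proof of Proposition 1, archimedean term)] -/
theorem exists_abs_setIntegral_reDigammaQuarter_sub_indicator_le :
    ∃ C : ℝ, 0 ≤ C ∧ ∀ h : ℝ, 0 < h → h ≤ 1 → ∀ t : ℝ,
      |(∫ u in Ioo (t - h / 2) (t + h / 2), reDigammaQuarter u) -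
          h * {t : ℝ | 4 ≤ |t|}.indicator (fun t ↦ Real.log (|t| / 2)) t| ≤ C * h := by
  obtain ⟨C, hC0, hC⟩ := exists_abs_setIntegral_reDigammaQuarter_sub_le
  refine ⟨C + (|reDigammaQuarter 0| + 27 * (9 / 2) ^ 2), by positivity, fun h hh hh1 t ↦ ?_⟩
  by_cases ht : 4 ≤ |t|
  · rw [indicator_of_mem (show t ∈ {t : ℝ | 4 ≤ |t|} from ht)]
    refine (hC h hh hh1 t ht).trans ?_
    have : 0 ≤ (|reDigammaQuarter 0| + 27 * (9 / 2) ^ 2) * h := by positivity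
    linarith
  · rw [indicator_of_notMem (show t ∉ {t : ℝ | 4 ≤ |t|} from ht), mul_zero, sub_zero]
    push Not at ht
    refine (abs_setIntegral_reDigammaQuarter_le hh hh1 ht.le).trans ?_
    have : 0 ≤ C * h := by positivity
    linarith

/-! ## M3-c. Fubini for the window functional `B_{T,h}` -/

/-- `‖R(t)‖ ≤ Σ_{n ≤ L} |r(n)|` (`|n^{−1/2−it}| = n^{−1/2} ≤ 1`). [cite: BondarenkoHeap2026, §2.1 p. 5 (R(t))] -/
theorem norm_dirichletPoly_le_sum (r : ℕ → ℝ) (L t : ℝ) :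
    ‖dirichletPoly r L t‖ ≤ ∑ n ∈ Finset.Icc 1 ⌊L⌋₊, |r n| := by
  unfold dirichletPoly
  refine (norm_sum_le _ _).trans (Finset.sum_le_sum fun n hn ↦ ?_)
  have hn1 : 1 ≤ n := (Finset.mem_Icc.mp hn).1
  rw [norm_mul, Complex.norm_real, Real.norm_eq_abs,
    Complex.norm_natCast_cpow_of_pos (by omega) _]
  have hre : (-(1 / 2 : ℂ) - t * Complex.I).re = -(1 / 2) := by simp
  rw [hre]
  have h1 : (n : ℝ) ^ (-(1 / 2 : ℝ)) ≤ 1 :=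
    Real.rpow_le_one_of_one_le_of_nonpos (by exact_mod_cast hn1) (by norm_num)
  exact mul_le_of_le_one_right (abs_nonneg _) h1

/-- The kernel of the window functional against a weight `ψ`:
`f(t, u) = |R(t)|² W_T(t) · 1_{|u−t|<h/2} ψ(u)` is integrable on `ℝ × ℝ` when `ψ` is continuous with
`|ψ(u)| ≤ K + |u|` (`W_T` and `|t| W_T` are integrable, `R` is bounded).
[cite: BondarenkoHeap2026, §2.2 (4) p. 6] -/
theorem integrable_windowKernel (w : Bump) (B : ℕ) (r : ℕ → ℝ) (L : ℝ) {T : ℝ} (hT : 0 < T)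
    {h : ℝ} (hh : 0 < h) (hh1 : h ≤ 1) {ψ : ℝ → ℝ} (hψc : Continuous ψ) {K : ℝ} (hK0 : 0 ≤ K)
    (hK : ∀ u, |ψ u| ≤ K + |u|) :
    Integrable (Function.uncurry fun t u : ℝ ↦
      ‖dirichletPoly r L t‖ ^ 2 * weight w B T t * (Ioo (t - h / 2) (t + h / 2)).indicator ψ u)
      (volume.prod volume) := by
  set G : ℝ → ℝ := fun t ↦ ‖dirichletPoly r L t‖ ^ 2 * weight w B T t with hG
  have hGc : Continuous G := ((continuous_dirichletPoly r L).norm.pow 2).mul (continuous_weight w B T)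
  have hG0 : ∀ t, 0 ≤ G t := fun t ↦ mul_nonneg (sq_nonneg _) (weight_nonneg w B T t)
  set R₀ : ℝ := ∑ n ∈ Finset.Icc 1 ⌊L⌋₊, |r n| with hR₀
  have hR₀0 : 0 ≤ R₀ := Finset.sum_nonneg fun n _ ↦ abs_nonneg _
  have hGle : ∀ t, G t ≤ R₀ ^ 2 * weight w B T t := by
    intro t
    apply mul_le_mul_of_nonneg_right _ (weight_nonneg w B T t)
    exact pow_le_pow_left₀ (norm_nonneg _) (norm_dirichletPoly_le_sum r L t) 2
  -- measurability on the product
  set S : Set (ℝ × ℝ) := {p | p.1 - h / 2 < p.2 ∧ p.2 < p.1 + h / 2} with hS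
  have hSo : IsOpen S :=
    (isOpen_lt (continuous_fst.sub continuous_const) continuous_snd).inter
      (isOpen_lt continuous_snd (continuous_fst.add continuous_const))
  have hF : (Function.uncurry fun t u : ℝ ↦ G t * (Ioo (t - h / 2) (t + h / 2)).indicator ψ u) =
      fun p : ℝ × ℝ ↦ G p.1 * S.indicator (fun p ↦ ψ p.2) p := by
    funext ⟨t, u⟩
    change G t * (Ioo (t - h / 2) (t + h / 2)).indicator ψ u = G t * S.indicator (fun p ↦ ψ p.2) (t, u)
    congr 1
  have hmeas : AEStronglyMeasurable (Function.uncurry fun t u : ℝ ↦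
      G t * (Ioo (t - h / 2) (t + h / 2)).indicator ψ u) (volume.prod volume) := by
    rw [hF]
    exact ((hGc.measurable.comp measurable_fst).mul
      ((hψc.measurable.comp measurable_snd).indicator hSo.measurableSet)).aestronglyMeasurable
  rw [integrable_prod_iff hmeas]
  constructor
  · refine Eventually.of_forall fun t ↦ ?_
    have hi : Integrable ((Ioo (t - h / 2) (t + h / 2)).indicator ψ) :=
      (integrable_indicator_iff measurableSet_Ioo).mpr
        ((hψc.integrableOn_Icc (a := t - h / 2) (b := t + h / 2)).mono_set Ioo_subset_Icc_self)
    exact hi.const_mul (G t)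
  · -- `∫_u ‖f(t,u)‖ ≤ G(t) h (K + 1 + |t|)`, an integrable majorant
    have hmaj : Integrable fun t : ℝ ↦ G t * (h * (K + 1 + |t|)) := by
      have h1 : Integrable fun t : ℝ ↦ R₀ ^ 2 * weight w B T t * (h * (K + 1 + |t|)) := by
        have ha := (Extension.integrable_weight w B hT).const_mul (R₀ ^ 2 * (h * (K + 1)))
        have hb := (Extension.integrable_abs_mul_weight w B hT).const_mul (R₀ ^ 2 * h)
        refine (ha.add hb).congr (Eventually.of_forall fun t ↦ ?_)
        simp only [Pi.add_apply]; ring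
      refine h1.mono' ((hGc.mul (continuous_const.mul (continuous_const.add
        continuous_abs))).aestronglyMeasurable) (Eventually.of_forall fun t ↦ ?_)
      rw [Real.norm_eq_abs, abs_of_nonneg (by have := hG0 t; positivity)]
      exact mul_le_mul_of_nonneg_right (hGle t) (by positivity)
    refine hmaj.mono' hmeas.norm.integral_prod_right' (Eventually.of_forall fun t ↦ ?_)
    rw [Real.norm_eq_abs, abs_of_nonneg (integral_nonneg fun u ↦ norm_nonneg _)]
    change ∫ u, ‖G t * (Ioo (t - h / 2) (t + h / 2)).indicator ψ u‖ ≤ G t * (h * (K + 1 + |t|))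
    have hvol : volume (Ioo (t - h / 2) (t + h / 2)) = ENNReal.ofReal h := by
      rw [Real.volume_Ioo]; congr 1; ring
    have hvol' : volume.real (Ioo (t - h / 2) (t + h / 2)) = h := by
      rw [Measure.real, hvol, ENNReal.toReal_ofReal hh.le]
    have e : (fun u ↦ ‖G t * (Ioo (t - h / 2) (t + h / 2)).indicator ψ u‖) =
        (Ioo (t - h / 2) (t + h / 2)).indicator fun u ↦ G t * |ψ u| := by
      funext u
      by_cases hu : u ∈ Ioo (t - h / 2) (t + h / 2)
      · rw [indicator_of_mem hu, indicator_of_mem hu, Real.norm_eq_abs, abs_mul, abs_of_nonneg (hG0 t)]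
      · rw [indicator_of_notMem hu, indicator_of_notMem hu, mul_zero, norm_zero]
    rw [e, integral_indicator measurableSet_Ioo]
    have hbound : ∀ u ∈ Ioo (t - h / 2) (t + h / 2), ‖G t * |ψ u|‖ ≤ G t * (K + 1 + |t|) := by
      intro u hu
      rw [Real.norm_eq_abs, abs_of_nonneg (by have := hG0 t; positivity)]
      apply mul_le_mul_of_nonneg_left _ (hG0 t)
      refine (hK u).trans ?_
      have : |u| ≤ |t| + 1 := by
        have h1 : |u - t| ≤ 1 := by rw [abs_le]; constructor <;> linarith [hu.1, hu.2]
        have h2 := abs_add_le (u - t) t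
        rw [sub_add_cancel] at h2
        linarith
      linarith
    have hI := norm_setIntegral_le_of_norm_le_const (by rw [hvol]; simp) hbound
    rw [Real.norm_eq_abs, hvol', abs_of_nonneg (integral_nonneg fun u ↦ by have := hG0 t; positivity)] at hI
    linarith

/-- **M3-c. Fubini for the window functional** (BH 2026, (4): "`I₁ = Σ_γ B_{T,h}(γ)` where
`B_{T,h}(u) = ∫ 1_{|u−t|<h/2} |R(t)|² W_T(t) dt`"; here against a continuous weight `ψ` of linear
growth, e.g. `ψ = Re ψ(1/4 + i·/2)` or `ψ ≡ 1`):
`∫ B_{T,h}(u) ψ(u) du = ∫ |R(t)|² W_T(t) (∫_{t−h/2}^{t+h/2} ψ(u) du) dt`.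
[cite: BondarenkoHeap2026, §2.2 (4) p. 6] -/
theorem integral_window_mul_eq (w : Bump) (B : ℕ) (r : ℕ → ℝ) (L : ℝ) {T : ℝ} (hT : 0 < T)
    {h : ℝ} (hh : 0 < h) (hh1 : h ≤ 1) {ψ : ℝ → ℝ} (hψc : Continuous ψ) {K : ℝ} (hK0 : 0 ≤ K)
    (hK : ∀ u, |ψ u| ≤ K + |u|) :
    ∫ u, (∫ t in Ioo (u - h / 2) (u + h / 2), ‖dirichletPoly r L t‖ ^ 2 * weight w B T t) * ψ u =
      ∫ t, ‖dirichletPoly r L t‖ ^ 2 * weight w B T t *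
        ∫ u in Ioo (t - h / 2) (t + h / 2), ψ u := by
  set G : ℝ → ℝ := fun t ↦ ‖dirichletPoly r L t‖ ^ 2 * weight w B T t with hG
  have hint := integrable_windowKernel w B r L hT hh hh1 hψc hK0 hK
  have hswap := integral_integral_swap hint
  -- left side = `∫ t, ∫ u, f t u` read in the order `u` outside
  have hL : ∀ u : ℝ, (∫ t in Ioo (u - h / 2) (u + h / 2), G t) * ψ u =
      ∫ t, G t * (Ioo (t - h / 2) (t + h / 2)).indicator ψ u := by
    intro u
    rw [← integral_indicator measurableSet_Ioo, ← integral_mul_const]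
    refine integral_congr_ae (Eventually.of_forall fun t ↦ ?_)
    by_cases ht : t ∈ Ioo (u - h / 2) (u + h / 2)
    · have hu : u ∈ Ioo (t - h / 2) (t + h / 2) := ⟨by linarith [ht.2], by linarith [ht.1]⟩
      simp only [indicator_of_mem ht, indicator_of_mem hu]
    · have hu : u ∉ Ioo (t - h / 2) (t + h / 2) := fun hu ↦ ht ⟨by linarith [hu.2], by linarith [hu.1]⟩
      simp only [indicator_of_notMem ht, indicator_of_notMem hu, zero_mul, mul_zero]
  have hR : ∀ t : ℝ, G t * ∫ u in Ioo (t - h / 2) (t + h / 2), ψ u =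
      ∫ u, G t * (Ioo (t - h / 2) (t + h / 2)).indicator ψ u := by
    intro t
    rw [← integral_indicator measurableSet_Ioo, integral_const_mul]
  rw [integral_congr_ae (Eventually.of_forall hL), integral_congr_ae (Eventually.of_forall hR)]
  exact hswap.symm

/-- The window functional integrates to `h I₀`: `∫ B_{T,h}(u) du = h ∫ |R(t)|² W_T(t) dt`.
[cite: BondarenkoHeap2026, §2.2 (4) p. 6] -/
theorem integral_window_eq (w : Bump) (B : ℕ) (r : ℕ → ℝ) (L : ℝ) {T : ℝ} (hT : 0 < T)
    {h : ℝ} (hh : 0 < h) (hh1 : h ≤ 1) :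
    ∫ u, (∫ t in Ioo (u - h / 2) (u + h / 2), ‖dirichletPoly r L t‖ ^ 2 * weight w B T t) =
      h * ∫ t, ‖dirichletPoly r L t‖ ^ 2 * weight w B T t := by
  have h1 := integral_window_mul_eq w B r L hT hh hh1 (ψ := fun _ ↦ (1 : ℝ)) continuous_const
    (K := 1) zero_le_one (fun u ↦ by rw [abs_one]; linarith [abs_nonneg u])
  simp only [mul_one] at h1
  rw [h1, ← integral_const_mul]
  refine integral_congr_ae (Eventually.of_forall fun t ↦ ?_)
  have hvol : volume (Ioo (t - h / 2) (t + h / 2)) = ENNReal.ofReal h := by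
    rw [Real.volume_Ioo]; congr 1; ring
  have hvol' : volume.real (Ioo (t - h / 2) (t + h / 2)) = h := by
    rw [Measure.real, hvol, ENNReal.toReal_ofReal hh.le]
  simp only [setIntegral_const, smul_eq_mul, mul_one, hvol']
  ring

/-! ## M3-d. The archimedean term of the explicit formula for `B_{T,h}` -/

/-- **M3-d. The archimedean term, localised to the window's mass:** for every bump `w` and `B` there
is an absolute `C` (independent of `r, L, T, h`) with
`|∫ B_{T,h}(u) Re ψ(1/4 + iu/2) du − h ∫ |R(t)|² W_T(t) ℓ(t) dt| ≤ C h ∫ |R(t)|² W_T(t) dt`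
for all `T > 0`, `0 < h ≤ 1`, where `ℓ(t) = log(|t|/2)` for `|t| ≥ 4` and `0` otherwise (BH 2026,
proof of Proposition 1: the `Γ'/Γ`-term of the explicit formula gives "`c I₀`" up to `O(I₀/log T)`
once `log(|t|/2) ≈ log T` on the support of `W_T` — that localisation is the next module's job).
[cite: BondarenkoHeap2026, §2.2 (proof of Proposition 1, archimedean term)] -/
theorem exists_abs_integral_window_mul_reDigammaQuarter_sub_le :
    ∃ C : ℝ, 0 ≤ C ∧ ∀ (w : Bump) (B : ℕ) (r : ℕ → ℝ) (L T : ℝ), 0 < T → ∀ h : ℝ, 0 < h → h ≤ 1 →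
      |(∫ u, (∫ t in Ioo (u - h / 2) (u + h / 2), ‖dirichletPoly r L t‖ ^ 2 * weight w B T t) *
            reDigammaQuarter u) -
          h * ∫ t, ‖dirichletPoly r L t‖ ^ 2 * weight w B T t *
            {t : ℝ | 4 ≤ |t|}.indicator (fun t ↦ Real.log (|t| / 2)) t| ≤
        C * h * ∫ t, ‖dirichletPoly r L t‖ ^ 2 * weight w B T t := by
  obtain ⟨C, hC0, hC⟩ := exists_abs_setIntegral_reDigammaQuarter_sub_indicator_le
  obtain ⟨K, hK0, hK⟩ := exists_abs_reDigammaQuarter_le_add_abs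
  refine ⟨C, hC0, fun w B r L T hT h hh hh1 ↦ ?_⟩
  set G : ℝ → ℝ := fun t ↦ ‖dirichletPoly r L t‖ ^ 2 * weight w B T t with hG
  have hGc : Continuous G := ((continuous_dirichletPoly r L).norm.pow 2).mul (continuous_weight w B T)
  have hG0 : ∀ t, 0 ≤ G t := fun t ↦ mul_nonneg (sq_nonneg _) (weight_nonneg w B T t)
  set R₀ : ℝ := ∑ n ∈ Finset.Icc 1 ⌊L⌋₊, |r n| with hR₀
  have hGle : ∀ t, G t ≤ R₀ ^ 2 * weight w B T t := by
    intro t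
    apply mul_le_mul_of_nonneg_right _ (weight_nonneg w B T t)
    exact pow_le_pow_left₀ (norm_nonneg _) (norm_dirichletPoly_le_sum r L t) 2
  have hGi : Integrable G :=
    ((Extension.integrable_weight w B hT).const_mul (R₀ ^ 2)).mono' hGc.aestronglyMeasurable
      (Eventually.of_forall fun t ↦ by rw [Real.norm_eq_abs, abs_of_nonneg (hG0 t)]; exact hGle t)
  -- Fubini
  rw [integral_window_mul_eq w B r L hT hh hh1 continuous_reDigammaQuarter hK0 hK]
  -- integrability of the two `t`-integrands
  set A : ℝ → ℝ := fun t ↦ ∫ u in Ioo (t - h / 2) (t + h / 2), reDigammaQuarter u with hA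
  set ℓ : ℝ → ℝ := {t : ℝ | 4 ≤ |t|}.indicator fun t ↦ Real.log (|t| / 2) with hℓ
  have hint := integrable_windowKernel w B r L hT hh hh1 continuous_reDigammaQuarter hK0 hK
  have hGA : Integrable fun t ↦ G t * A t := by
    have h1 := hint.integral_prod_left
    refine h1.congr (Eventually.of_forall fun t ↦ ?_)
    change ∫ u, G t * (Ioo (t - h / 2) (t + h / 2)).indicator reDigammaQuarter u = G t * A t
    rw [integral_const_mul, integral_indicator measurableSet_Ioo]
  have hℓm : Measurable ℓ := by
    refine (Measurable.indicator ?_ (measurableSet_le measurable_const continuous_abs.measurable))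
    exact (Real.measurable_log.comp (continuous_abs.measurable.div_const 2))
  have hℓle : ∀ t, |ℓ t| ≤ |t| := by
    intro t
    rw [hℓ]
    by_cases ht : t ∈ {t : ℝ | 4 ≤ |t|}
    · rw [indicator_of_mem ht]
      have ht' : 4 ≤ |t| := ht
      have h1 : 0 ≤ Real.log (|t| / 2) := Real.log_nonneg (by linarith)
      rw [abs_of_nonneg h1]
      have h2 : Real.log (|t| / 2) ≤ |t| / 2 - 1 := Real.log_le_sub_one_of_pos (by linarith)
      linarith [abs_nonneg t]
    · rw [indicator_of_notMem ht, abs_zero]; exact abs_nonneg t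
  have hGℓ : Integrable fun t ↦ G t * ℓ t := by
    have h1 : Integrable fun t : ℝ ↦ R₀ ^ 2 * (|t| * weight w B T t) :=
      (Extension.integrable_abs_mul_weight w B hT).const_mul _
    refine h1.mono' (hGc.measurable.mul hℓm).aestronglyMeasurable (Eventually.of_forall fun t ↦ ?_)
    rw [Real.norm_eq_abs, abs_mul, abs_of_nonneg (hG0 t)]
    calc G t * |ℓ t| ≤ R₀ ^ 2 * weight w B T t * |t| := mul_le_mul (hGle t) (hℓle t) (abs_nonneg _)
          (mul_nonneg (sq_nonneg _) (weight_nonneg w B T t))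
      _ = R₀ ^ 2 * (|t| * weight w B T t) := by ring
  -- the difference as one integral, bounded pointwise by `C h G(t)`
  have e : (∫ t, G t * A t) - h * ∫ t, G t * ℓ t = ∫ t, G t * (A t - h * ℓ t) := by
    rw [← integral_const_mul, ← integral_sub hGA (hGℓ.const_mul h)]
    refine integral_congr_ae (Eventually.of_forall fun t ↦ ?_)
    ring
  rw [e]
  have hbound : ∀ t, ‖G t * (A t - h * ℓ t)‖ ≤ C * h * G t := by
    intro t
    rw [Real.norm_eq_abs, abs_mul, abs_of_nonneg (hG0 t)]
    have := hC h hh hh1 t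
    calc G t * |A t - h * ℓ t| ≤ G t * (C * h) := mul_le_mul_of_nonneg_left this (hG0 t)
      _ = C * h * G t := by ring
  calc |∫ t, G t * (A t - h * ℓ t)| = ‖∫ t, G t * (A t - h * ℓ t)‖ := (Real.norm_eq_abs _).symm
    _ ≤ ∫ t, C * h * G t := norm_integral_le_of_norm_le (hGi.const_mul _) (Eventually.of_forall hbound)
    _ = C * h * ∫ t, G t := integral_const_mul _ _

/-- **M3-d in the programme's frozen interface shape** (ah/STATUS 07:51:43Z): with `h = 2πc/log T`
(`gapWidth c T ∈ (0, 1]`), `B_{T,h} = bWindow`, `I₀ = I0R`,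
`|(1/2π) ∫ B_{T,h}(u) Re ψ(1/4 + iu/2) du − (h/2π) ∫_{|t|≥4} |R(t)|² W_T(t) log(|t|/2) dt| ≤ (C/2π) h I₀`,
one absolute constant `C` for all `c, w, B, r, L, T`.
[cite: BondarenkoHeap2026, §2.2 (proof of Proposition 1, archimedean term)] -/
theorem exists_abs_archimedean_bWindow_sub_le :
    ∃ C : ℝ, 0 ≤ C ∧ ∀ (c : ℝ) (w : Bump) (B : ℕ) (r : ℕ → ℝ) (L T : ℝ), 0 < T →
      0 < gapWidth c T → gapWidth c T ≤ 1 →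
      |1 / (2 * π) * (∫ u, bWindow c w B r L T u * reDigammaQuarter u) -
          gapWidth c T / (2 * π) *
            ∫ t in {t : ℝ | 4 ≤ |t|}, ‖dirichletPoly r L t‖ ^ 2 * weight w B T t * Real.log (|t| / 2)| ≤
        C / (2 * π) * gapWidth c T * I0R w B r L T := by
  obtain ⟨C, hC0, hC⟩ := exists_abs_integral_window_mul_reDigammaQuarter_sub_le
  refine ⟨C, hC0, fun c w B r L T hT hh hh1 ↦ ?_⟩
  have h := hC w B r L T hT (gapWidth c T) hh hh1
  have hS : MeasurableSet {t : ℝ | 4 ≤ |t|} := measurableSet_le measurable_const continuous_abs.measurable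
  have e1 : (∫ t in {t : ℝ | 4 ≤ |t|}, ‖dirichletPoly r L t‖ ^ 2 * weight w B T t * Real.log (|t| / 2)) =
      ∫ t, ‖dirichletPoly r L t‖ ^ 2 * weight w B T t *
        {t : ℝ | 4 ≤ |t|}.indicator (fun t ↦ Real.log (|t| / 2)) t := by
    rw [← integral_indicator hS]
    refine integral_congr_ae (Eventually.of_forall fun t ↦ ?_)
    exact Set.indicator_mul_right _ _ _
  have e2 : (∫ u, bWindow c w B r L T u * reDigammaQuarter u) =
      ∫ u, (∫ t in Ioo (u - gapWidth c T / 2) (u + gapWidth c T / 2),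
        ‖dirichletPoly r L t‖ ^ 2 * weight w B T t) * reDigammaQuarter u := rfl
  rw [e1, e2, I0R]
  have e3 : 1 / (2 * π) * (∫ u, (∫ t in Ioo (u - gapWidth c T / 2) (u + gapWidth c T / 2),
        ‖dirichletPoly r L t‖ ^ 2 * weight w B T t) * reDigammaQuarter u) -
      gapWidth c T / (2 * π) * ∫ t, ‖dirichletPoly r L t‖ ^ 2 * weight w B T t *
        {t : ℝ | 4 ≤ |t|}.indicator (fun t ↦ Real.log (|t| / 2)) t =
      (1 / (2 * π)) * ((∫ u, (∫ t in Ioo (u - gapWidth c T / 2) (u + gapWidth c T / 2),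
        ‖dirichletPoly r L t‖ ^ 2 * weight w B T t) * reDigammaQuarter u) -
      gapWidth c T * ∫ t, ‖dirichletPoly r L t‖ ^ 2 * weight w B T t *
        {t : ℝ | 4 ≤ |t|}.indicator (fun t ↦ Real.log (|t| / 2)) t) := by ring
  rw [e3, abs_mul, abs_of_pos (by positivity : (0 : ℝ) < 1 / (2 * π))]
  calc 1 / (2 * π) * |(∫ u, (∫ t in Ioo (u - gapWidth c T / 2) (u + gapWidth c T / 2),
        ‖dirichletPoly r L t‖ ^ 2 * weight w B T t) * reDigammaQuarter u) -
      gapWidth c T * ∫ t, ‖dirichletPoly r L t‖ ^ 2 * weight w B T t *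
        {t : ℝ | 4 ≤ |t|}.indicator (fun t ↦ Real.log (|t| / 2)) t|
      ≤ 1 / (2 * π) * (C * gapWidth c T * ∫ t, ‖dirichletPoly r L t‖ ^ 2 * weight w B T t) :=
        mul_le_mul_of_nonneg_left h (by positivity)
    _ = C / (2 * π) * gapWidth c T * ∫ t, ‖dirichletPoly r L t‖ ^ 2 * weight w B T t := by ring

/-- Closed and open windows agree: `∫_{[u−h/2, u+h/2]} |R|² W_T = B_{T,h}(u)` (the endpoints are
Lebesgue-null; BH's `1_{|u−t|<h/2}` vs the closed window of `Prop1TestFunction.BC_ofReal`).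
[cite: BondarenkoHeap2026, §2.2 (4) p. 6] -/
theorem setIntegral_Icc_eq_bWindow (c : ℝ) (w : Bump) (B : ℕ) (r : ℕ → ℝ) (L T u : ℝ) :
    ∫ t in Icc (u - gapWidth c T / 2) (u + gapWidth c T / 2), ‖dirichletPoly r L t‖ ^ 2 * weight w B T t =
      bWindow c w B r L T u := by
  rw [bWindow, integral_Icc_eq_integral_Ioo]

end Arch

end BondarenkoHeap2026

end Literature.NumberTheory.LFunctions

end
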